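import Summits.AtomisticToContinuum.HydrodynamicLimit.Theses.TwoClocks
import Summits.AtomisticToContinuum.HydrodynamicLimit.Theorems.ImplosionDichotomyHydroLimitInBandOfHeart
import Literature.MathematicalPhysics.KineticTheory.HardSphereUniformGas
import Literature.Analysis.FunctionSpaces.TorusSpaceTime
import Literature.Analysis.FunctionSpaces.TorusCalculusProofs
import HarnessLib

/-!
# Child (iii) of the dock contains TwoClocks' crux C′ (line `Sketch`, crux `ClampedTransferDock`, stmt-AtomisticToContinuum-16665)

Support file (`--supports stmt-AtomisticToContinuum-16665`; registered support signature `clampedTransferWindowLD_of_family`): the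
registered stub `stub_localClampedTransferLD : LocalClampedTransferWindowLDFamily` (child (iii) of the dock, conjecture-grade) implies
`TwoClocks.ClampedTransferWindowLD` (crux stmt-AtomisticToContinuum-16623, the repaired equilibrium statement C′ of the Lean-refuted
stmt-13733) by specialisation to constant families — bookkeeping that makes the route's "constant-family rung = C′ 1:1" claim checkable
and records for the planner that promoting (iii) subsumes 16623. Worker audit of lead prover-line-stmt-AtomisticToContinuum-16665-0,
cycle 1 (file `work/stubs/audit_localClampedTransferLD.lean`, AUDIT-localClampedTransferLD.md attached to the item).
-/

noncomputable section

namespace Summit.AtomisticToContinuum.HydrodynamicLimit.Theorems.ClampedTransferDockBridge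

open MeasureTheory Set
open Literature.MathematicalPhysics.KineticTheory Literature.Analysis.FluidPDE Literature.Analysis.FunctionSpaces
open Summit.AtomisticToContinuum.HydrodynamicLimit.Theses
open Summit.AtomisticToContinuum.HydrodynamicLimit.Theorems.HydroLimitInBandOfHeart

/-- `rhoLim ≡ 1` for a constant activity, via `profileOf_const` (one `SmallDensity` threshold of the uniform profile serves all constants `a₀`). [folklore] -/
theorem rhoLim_const {a₀ σ : ℝ} (ha₀ : 0 < a₀) (h : SmallDensity uniformProfile σ) (x : T3) :
    rhoLim (profileOf (fun _ : T3 => a₀) continuous_const fun _ => ha₀) σ x = 1 := by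
  rw [profileOf_const ha₀]; exact rhoLim_uniform h x

/-- **The constant-family rung of child (iii) `LocalClampedTransferWindowLDFamily` IS TwoClocks' crux C′ = `ClampedTransferWindowLD`
(stmt-AtomisticToContinuum-16623)** — registered support signature `clampedTransferWindowLD_of_family` of line Sketch, crux ClampedTransferDock:
instantiate the family statement at `t₁ := 0` with constant profiles and the time-constant test function; `rhoLim` of a constant activity
is `≡ 1` (so the x-frozen EOS coefficients are the constants `Z(σ³)`, `Z′(σ³)`), the two deterministic centrings are multiples of
`∫ ∂_k φ = 0`, after which the two window functionals coincide syntactically. Makes the route's claim "the constant-family instance of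
(iii) is the equilibrium C′ (13733 restated 1:1, = stmt-16623)" kernel-checked: (iii) is at least crux 16623. [folklore] -/
theorem clampedTransferWindowLD_of_family (h : LocalClampedTransferWindowLDFamily) :
    TwoClocks.ClampedTransferWindowLD := by
  obtain ⟨η₀, hη₀, H⟩ := h
  obtain ⟨σ₁, hσ₁, Hσ₁⟩ := exists_smallDensity uniformProfile one_pos
  refine ⟨min (min σ₁ (1 / 2)) η₀, lt_min (lt_min hσ₁ (by norm_num)) hη₀, ?_⟩
  intro a₀ θ₀ u₀ ha₀ hθ₀ σ hσ hσlt Φ φ hφ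
  have hσ₁' : σ < σ₁ := hσlt.trans_le ((min_le_left _ _).trans (min_le_left _ _))
  have hσ2 : σ < 1 / 2 := hσlt.trans_le ((min_le_left _ _).trans (min_le_right _ _))
  have hση : σ < η₀ := hσlt.trans_le (min_le_right _ _)
  have hSD : SmallDensity uniformProfile σ := (Hσ₁ σ hσ hσ₁').1
  have hguard : ∀ s ∈ Icc (0 : ℝ) 0, σ ^ 3 * (⨆ _x : T3, a₀) ≤ η₀ * ∫ _x : T3, a₀ := by
    intro s _
    rw [ciSup_const, integral_const, smul_eq_mul, probReal_univ, one_mul]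
    have h3 : σ ^ 3 ≤ σ := by
      have : σ ^ 3 ≤ σ ^ 1 := pow_le_pow_of_le_one hσ.le (by linarith) (by norm_num)
      simpa using this
    exact mul_le_mul_of_nonneg_right (h3.trans hση.le) ha₀.le
  have hF := H 0 (fun _ _ => a₀) (fun _ _ => θ₀) (fun _ _ => u₀) (fun _ => continuous_const) continuous_const
    continuous_const continuous_const (fun _ _ => ha₀) (fun _ _ => hθ₀) σ hσ hσ2 hguard Φ (fun _ => φ)
    (Torus.isSmoothSpaceTimeOn_const hφ _)
  obtain ⟨V₀, hV₀, hF⟩ := hF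
  refine ⟨V₀, hV₀, fun V hV => ?_⟩
  obtain ⟨β₀, hβ₀, hF⟩ := hF V hV
  refine ⟨β₀, hβ₀, fun β hβ ε hε => ?_⟩
  obtain ⟨τ₀, hτ₀, hF⟩ := hF β hβ ε hε
  refine ⟨τ₀, hτ₀, fun τ hτ => ?_⟩
  obtain ⟨N₀, hF⟩ := hF τ hτ
  refine ⟨N₀, fun N hN => ?_⟩
  have hF := hF N hN 0 ⟨le_rfl, le_rfl⟩
  have hρ : ∀ x, rhoLim (profileOf (fun _ : T3 => a₀) continuous_const fun _ => ha₀) σ x = 1 :=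
    rhoLim_const ha₀ hSD
  have hint : ∀ k : Fin 3, ∫ x, Torus.partialDeriv k φ x = 0 := fun k =>
    Torus.integral_partialDeriv_eq_zero_holds hφ k
  have hc1 : ∀ (k : Fin 3) (c : ℝ), ∫ x, Torus.partialDeriv k φ x * c = 0 := fun k c => by
    rw [integral_mul_const, hint k, zero_mul]
  have hc2 : ∀ c : ℝ, ∫ x, (∑ l : Fin 3, u₀ l * Torus.partialDeriv l φ x) * c = 0 := fun c => by
    rw [integral_mul_const]
    have : ∫ x, ∑ l : Fin 3, u₀ l * Torus.partialDeriv l φ x = 0 := by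
      rw [integral_finsetSum _ fun l _ => ?_]
      · simp_rw [integral_const_mul, hint, mul_zero, Finset.sum_const_zero]
      · exact (((hφ.partialDeriv l).continuous).integrable_of_hasCompactSupport
          (HasCompactSupport.of_compactSpace _)).const_mul _
    rw [this, zero_mul]
  simp only [hρ, one_mul, hc1, hc2, mul_zero, sub_zero] at hF
  exact hF

end Summit.AtomisticToContinuum.HydrodynamicLimit.Theorems.ClampedTransferDockBridge

end
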